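import Summits.Ventures.PercRepro.C041PendantSets

/-!
# ROW C-041 — GLUING TWO ZONES AT THEIR ANCHORS: the glued zone and its zone sets (p6, gen 29; C-041.md §20 (b)(3)
«Π is multiplicative over the blocks at the anchor»)

`glue Z₂ a₂ Z₃ a₃` identifies the anchor `a₃` of `Z₃` with the anchor `a₂` of `Z₂`, BOTH zones keeping their marks;
the graph is that of `pendant Z₂ a₂ Z₃ a₃` (`C041PendantZone`), so its reaches are the pendant's (`cAdj_glue`,
`inl_mem_reach_iff`, `inr_mem_reach_iff`), and its marks are both sides' (`inl_mem_markSet_glue`, `inr_mem_markSet_glue`).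
At the anchor: `inl a₂ ∈ D ⟺ a₂ ∈ D₂ ∨ a₃ ∈ D₃` (`inl_a_mem_D_iff`; side `2` alike), ADMISSIBILITY is
`adm₂ ∧ adm₃ ∧ ¬ (inl a₂ ∈ D ∧ inl a₂ ∈ D2)` (`adm_iff`: the merged anchor sub-zone must not collect a blue `1`-mark
from one side and a blue `2`-mark from the other), «blue at `K`» is `blueK₂ ∧ blueK₃` (`blueK_iff`).  Admissibility and «blue at `K`» are in `C041AnchorGlueSets`.
-/

namespace PercRepro

namespace ZoneZ

namespace AnchorGlue

open ZoneData Pendant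

universe u₁ u₂ u₃ u₄ u₅ u₆ u₇ u₈

variable {V₂ : Type u₁} {E₂ : Type u₂} {S₁ : Type u₃} {S₂ : Type u₄} {V₃ : Type u₅} {E₃ : Type u₆}
  {R₁ : Type u₇} {R₂ : Type u₈}
variable (Z₂ : ZoneData V₂ E₂ S₁ S₂) (a₂ : V₂) (Z₃ : ZoneData V₃ E₃ R₁ R₂) (a₃ : V₃)

/-! ## The glued zone -/

/-- THE ANCHOR GLUING: `Z₃` with its anchor identified with the anchor of `Z₂`; both sides keep their marks. -/
noncomputable def glue : ZoneData (V₂ ⊕ V₃) (E₂ ⊕ E₃) (S₁ ⊕ R₁) (S₂ ⊕ R₂) where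
  fst := Sum.elim (fun e => Sum.inl (Z₂.fst e)) (fun e => red a₂ a₃ (Z₃.fst e))
  snd := Sum.elim (fun e => Sum.inl (Z₂.snd e)) (fun e => red a₂ a₃ (Z₃.snd e))
  at₁ := Sum.elim (fun t => Sum.inl (Z₂.at₁ t)) (fun t => red a₂ a₃ (Z₃.at₁ t))
  at₂ := Sum.elim (fun t => Sum.inl (Z₂.at₂ t)) (fun t => red a₂ a₃ (Z₃.at₂ t))

/-- The state of `Z₂` in a state of the glued zone. -/
def restrL (σ : State (E₂ ⊕ E₃) (S₁ ⊕ R₁) (S₂ ⊕ R₂)) : State E₂ S₁ S₂ :=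
  (fun e => σ.1 (Sum.inl e), fun t => σ.2.1 (Sum.inl t), fun t => σ.2.2 (Sum.inl t))

/-- The state of `Z₃` in a state of the glued zone. -/
def restrR (σ : State (E₂ ⊕ E₃) (S₁ ⊕ R₁) (S₂ ⊕ R₂)) : State E₃ R₁ R₂ :=
  (fun e => σ.1 (Sum.inr e), fun t => σ.2.1 (Sum.inr t), fun t => σ.2.2 (Sum.inr t))

/-- The same colouring as a state of the pendant attachment (dummy marks), to borrow its reach lemmas. -/
def asPendant (σ : State (E₂ ⊕ E₃) (S₁ ⊕ R₁) (S₂ ⊕ R₂)) : State (E₂ ⊕ E₃) R₁ R₂ :=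
  (σ.1, fun _ => true, fun _ => true)

variable (c : Bool) (σ : State (E₂ ⊕ E₃) (S₁ ⊕ R₁) (S₂ ⊕ R₂))

/-- The glued zone has the graph of the pendant attachment. -/
theorem cAdj_glue : cAdj (glue Z₂ a₂ Z₃ a₃) c σ.1 = cAdj (pendant Z₂ a₂ Z₃ a₃) c (asPendant σ).1 := rfl

/-- The left colouring. -/
theorem colL_asPendant : colL (asPendant σ) = (restrL σ).1 := rfl

/-- The right colouring. -/
theorem restr_asPendant_fst : (restr (asPendant σ)).1 = (restrR σ).1 := rfl

/-- **A `Z₂`-vertex is reached** iff it is reached inside `Z₂` from the left part of `S`, or connected to the anchor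
with the junction condition. -/
theorem inl_mem_reach_iff (S : Set (V₂ ⊕ V₃)) (hS : Sum.inr a₃ ∉ S) (x : V₂) :
    Sum.inl x ∈ reach (cAdj (glue Z₂ a₂ Z₃ a₃) c σ.1) S ↔
      x ∈ reach (cAdj Z₂ c (restrL σ).1) (leftSet S) ∨
        (junction Z₂ a₂ Z₃ a₃ c (asPendant σ) S ∧ x ∈ reach (cAdj Z₂ c (restrL σ).1) {a₂}) := by
  rw [cAdj_glue]
  exact Pendant.inl_mem_reach_iff Z₂ a₂ Z₃ a₃ c (asPendant σ) S hS x

/-- **A `Z₃`-vertex is reached** iff it is not the stray vertex and is reached inside `Z₃` from the right part of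
`S`, or connected to `a₃` with the junction condition. -/
theorem inr_mem_reach_iff (S : Set (V₂ ⊕ V₃)) (hS : Sum.inr a₃ ∉ S) (y : V₃) :
    Sum.inr y ∈ reach (cAdj (glue Z₂ a₂ Z₃ a₃) c σ.1) S ↔
      y ≠ a₃ ∧ (y ∈ reach (cAdj Z₃ c (restrR σ).1) (rightSet S) ∨
        (junction Z₂ a₂ Z₃ a₃ c (asPendant σ) S ∧ y ∈ reach (cAdj Z₃ c (restrR σ).1) {a₃})) := by
  rw [cAdj_glue]
  exact Pendant.inr_mem_reach_iff Z₂ a₂ Z₃ a₃ c (asPendant σ) S hS y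

/-! ## Marks -/

/-- A mark set of the glued zone at a `Z₂`-vertex: the left marks there, or the right anchor's marks at the anchor. -/
theorem inl_mem_markSet_glue {T T' : Type*} (atL : T → V₂) (atR : T' → V₃) (m : T ⊕ T' → Bool) (b : Bool)
    (x : V₂) :
    Sum.inl x ∈ markSet (Sum.elim (fun t => Sum.inl (atL t)) (fun t => red a₂ a₃ (atR t))) m b ↔
      x ∈ markSet atL (fun t => m (Sum.inl t)) b ∨ (x = a₂ ∧ a₃ ∈ markSet atR (fun t => m (Sum.inr t)) b) := by
  unfold markSet
  constructor
  · rintro ⟨t, ht, hm⟩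
    rcases t with t | t
    · simp only [Sum.elim_inl, Sum.inl.injEq] at ht
      exact Or.inl ⟨t, ht, hm⟩
    · simp only [Sum.elim_inr] at ht
      obtain ⟨h1, h2⟩ := eq_of_red_eq_inl ht
      exact Or.inr ⟨h2, t, h1, hm⟩
  · rintro (⟨t, ht, hm⟩ | ⟨rfl, t, ht, hm⟩)
    · exact ⟨Sum.inl t, by simp [ht], hm⟩
    · exact ⟨Sum.inr t, by simp [ht, red_self], hm⟩

/-- A mark set of the glued zone at a `Z₃`-vertex: the right marks there, off the right anchor. -/
theorem inr_mem_markSet_glue {T T' : Type*} (atL : T → V₂) (atR : T' → V₃) (m : T ⊕ T' → Bool) (b : Bool)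
    (y : V₃) :
    Sum.inr y ∈ markSet (Sum.elim (fun t => Sum.inl (atL t)) (fun t => red a₂ a₃ (atR t))) m b ↔
      y ≠ a₃ ∧ y ∈ markSet atR (fun t => m (Sum.inr t)) b := by
  unfold markSet
  constructor
  · rintro ⟨t, ht, hm⟩
    rcases t with t | t
    · simp at ht
    · simp only [Sum.elim_inr] at ht
      obtain ⟨h1, h2⟩ := eq_of_red_eq_inr ht
      rw [h2] at h1
      exact ⟨h1, t, h2, hm⟩
  · rintro ⟨hy, t, ht, hm⟩
    exact ⟨Sum.inr t, by simp [ht, red_of_ne a₂ hy], hm⟩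

/-- The stray vertex carries no mark. -/
theorem stray_not_mem_markSet_glue {T T' : Type*} (atL : T → V₂) (atR : T' → V₃) (m : T ⊕ T' → Bool)
    (b : Bool) : Sum.inr a₃ ∉ markSet (Sum.elim (fun t => Sum.inl (atL t)) (fun t => red a₂ a₃ (atR t))) m b := by
  rw [inr_mem_markSet_glue]
  exact fun h => h.1 rfl

/-- `Bl` at a `Z₂`-vertex. -/
theorem inl_mem_Bl_iff (x : V₂) :
    Sum.inl x ∈ (glue Z₂ a₂ Z₃ a₃).Bl σ ↔ x ∈ Z₂.Bl (restrL σ) ∨ (x = a₂ ∧ a₃ ∈ Z₃.Bl (restrR σ)) :=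
  inl_mem_markSet_glue a₂ a₃ Z₂.at₁ Z₃.at₁ σ.2.1 false x
/-- `Bl` at a `Z₃`-vertex. -/
theorem inr_mem_Bl_iff (y : V₃) : Sum.inr y ∈ (glue Z₂ a₂ Z₃ a₃).Bl σ ↔ y ≠ a₃ ∧ y ∈ Z₃.Bl (restrR σ) :=
  inr_mem_markSet_glue a₂ a₃ Z₂.at₁ Z₃.at₁ σ.2.1 false y
/-- `Blt` at a `Z₂`-vertex. -/
theorem inl_mem_Blt_iff (x : V₂) :
    Sum.inl x ∈ (glue Z₂ a₂ Z₃ a₃).Blt σ ↔ x ∈ Z₂.Blt (restrL σ) ∨ (x = a₂ ∧ a₃ ∈ Z₃.Blt (restrR σ)) :=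
  inl_mem_markSet_glue a₂ a₃ Z₂.at₁ Z₃.at₁ σ.2.1 true x
/-- `Blt` at a `Z₃`-vertex. -/
theorem inr_mem_Blt_iff (y : V₃) : Sum.inr y ∈ (glue Z₂ a₂ Z₃ a₃).Blt σ ↔ y ≠ a₃ ∧ y ∈ Z₃.Blt (restrR σ) :=
  inr_mem_markSet_glue a₂ a₃ Z₂.at₁ Z₃.at₁ σ.2.1 true y
/-- `M` at a `Z₂`-vertex. -/
theorem inl_mem_M_iff (x : V₂) :
    Sum.inl x ∈ (glue Z₂ a₂ Z₃ a₃).M σ ↔ x ∈ Z₂.M (restrL σ) ∨ (x = a₂ ∧ a₃ ∈ Z₃.M (restrR σ)) :=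
  inl_mem_markSet_glue a₂ a₃ Z₂.at₂ Z₃.at₂ σ.2.2 false x
/-- `M` at a `Z₃`-vertex. -/
theorem inr_mem_M_iff (y : V₃) : Sum.inr y ∈ (glue Z₂ a₂ Z₃ a₃).M σ ↔ y ≠ a₃ ∧ y ∈ Z₃.M (restrR σ) :=
  inr_mem_markSet_glue a₂ a₃ Z₂.at₂ Z₃.at₂ σ.2.2 false y
/-- `Mt` at a `Z₂`-vertex. -/
theorem inl_mem_Mt_iff (x : V₂) :
    Sum.inl x ∈ (glue Z₂ a₂ Z₃ a₃).Mt σ ↔ x ∈ Z₂.Mt (restrL σ) ∨ (x = a₂ ∧ a₃ ∈ Z₃.Mt (restrR σ)) :=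
  inl_mem_markSet_glue a₂ a₃ Z₂.at₂ Z₃.at₂ σ.2.2 true x
/-- `Mt` at a `Z₃`-vertex. -/
theorem inr_mem_Mt_iff (y : V₃) : Sum.inr y ∈ (glue Z₂ a₂ Z₃ a₃).Mt σ ↔ y ≠ a₃ ∧ y ∈ Z₃.Mt (restrR σ) :=
  inr_mem_markSet_glue a₂ a₃ Z₂.at₂ Z₃.at₂ σ.2.2 true y

/-! ## The deleted vertices -/

/-- The reach of a left set enlarged by the anchor under a condition. -/
theorem mem_reach_union_condSingleton {V : Type*} (R : V → V → Prop) (B : Set V) (a x : V) (P : Prop) :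
    x ∈ reach R {v | v ∈ B ∨ (v = a ∧ P)} ↔ x ∈ reach R B ∨ (P ∧ x ∈ reach R {a}) := by
  constructor
  · rintro ⟨s, hs | ⟨hs, hP⟩, hsx⟩
    · exact Or.inl ⟨s, hs, hsx⟩
    · rw [hs] at hsx
      exact Or.inr ⟨hP, a, rfl, hsx⟩
  · rintro (⟨s, hs, hsx⟩ | ⟨hP, s, hs, hsx⟩)
    · exact ⟨s, Or.inl hs, hsx⟩
    · rw [Set.mem_singleton_iff] at hs
      rw [hs] at hsx
      exact ⟨a, Or.inr ⟨rfl, hP⟩, hsx⟩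

/-- The junction condition for a glued mark set: the anchor is reached on either side. -/
theorem junction_markSet_iff (c : Bool) {T T' : Type*} (atL : T → V₂) (atR : T' → V₃) (m : T ⊕ T' → Bool)
    (b : Bool) :
    junction Z₂ a₂ Z₃ a₃ c (asPendant σ)
        (markSet (Sum.elim (fun t => Sum.inl (atL t)) (fun t => red a₂ a₃ (atR t))) m b) ↔
      a₂ ∈ reach (cAdj Z₂ c (restrL σ).1) (markSet atL (fun t => m (Sum.inl t)) b) ∨
        a₃ ∈ reach (cAdj Z₃ c (restrR σ).1) (markSet atR (fun t => m (Sum.inr t)) b) := by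
  unfold junction
  rw [colL_asPendant, restr_asPendant_fst]
  have e1 : leftSet (markSet (Sum.elim (fun t => Sum.inl (atL t)) (fun t => red a₂ a₃ (atR t))) m b) =
      {x | x ∈ markSet atL (fun t => m (Sum.inl t)) b ∨ (x = a₂ ∧ a₃ ∈ markSet atR (fun t => m (Sum.inr t)) b)} := by
    ext x
    exact inl_mem_markSet_glue a₂ a₃ atL atR m b x
  have e2 : rightSet (markSet (Sum.elim (fun t => Sum.inl (atL t)) (fun t => red a₂ a₃ (atR t))) m b) =
      {y | y ≠ a₃ ∧ y ∈ markSet atR (fun t => m (Sum.inr t)) b} := by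
    ext y
    exact inr_mem_markSet_glue a₂ a₃ atL atR m b y
  rw [e1, e2, mem_reach_union_condSingleton,
    mem_reach_self_iff_avoid (cAdj Z₃ c (restrR σ).1) (markSet atR (fun t => m (Sum.inr t)) b) a₃]
  constructor
  · rintro ((h | ⟨h, -⟩) | h)
    · exact Or.inl h
    · exact Or.inr (Or.inl h)
    · exact Or.inr (Or.inr h)
  · rintro (h | h | h)
    · exact Or.inl (Or.inl h)
    · exact Or.inl (Or.inr ⟨h, mem_reach_of_mem rfl⟩)
    · exact Or.inr h

/-- The anchor is reached from a glued mark set iff it is reached on either side. -/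
theorem inl_a_mem_reach_markSet_iff (c : Bool) {T T' : Type*} (atL : T → V₂) (atR : T' → V₃)
    (m : T ⊕ T' → Bool) (b : Bool) :
    Sum.inl a₂ ∈ reach (cAdj (glue Z₂ a₂ Z₃ a₃) c σ.1)
        (markSet (Sum.elim (fun t => Sum.inl (atL t)) (fun t => red a₂ a₃ (atR t))) m b) ↔
      a₂ ∈ reach (cAdj Z₂ c (restrL σ).1) (markSet atL (fun t => m (Sum.inl t)) b) ∨
        a₃ ∈ reach (cAdj Z₃ c (restrR σ).1) (markSet atR (fun t => m (Sum.inr t)) b) := by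
  rw [inl_mem_reach_iff Z₂ a₂ Z₃ a₃ c σ _ (stray_not_mem_markSet_glue a₂ a₃ atL atR m b), junction_markSet_iff]
  have e1 : leftSet (markSet (Sum.elim (fun t => Sum.inl (atL t)) (fun t => red a₂ a₃ (atR t))) m b) =
      {x | x ∈ markSet atL (fun t => m (Sum.inl t)) b ∨ (x = a₂ ∧ a₃ ∈ markSet atR (fun t => m (Sum.inr t)) b)} := by
    ext x
    exact inl_mem_markSet_glue a₂ a₃ atL atR m b x
  rw [e1, mem_reach_union_condSingleton]
  constructor
  · rintro ((h | ⟨h, -⟩) | ⟨h, -⟩)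
    · exact Or.inl h
    · exact Or.inr (mem_reach_of_mem h)
    · exact h
  · intro h
    exact Or.inr ⟨h, mem_reach_of_mem rfl⟩

/-- **The anchor is deleted** iff it is deleted in `Z₂` or `a₃` is deleted in `Z₃`. -/
theorem inl_a_mem_D_iff :
    Sum.inl a₂ ∈ (glue Z₂ a₂ Z₃ a₃).D σ ↔ a₂ ∈ Z₂.D (restrL σ) ∨ a₃ ∈ Z₃.D (restrR σ) :=
  inl_a_mem_reach_markSet_iff Z₂ a₂ Z₃ a₃ σ false Z₂.at₁ Z₃.at₁ σ.2.1 false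

/-- **The anchor is deleted on side `2`** iff it is in `Z₂` or `a₃` is in `Z₃`. -/
theorem inl_a_mem_D2_iff :
    Sum.inl a₂ ∈ (glue Z₂ a₂ Z₃ a₃).D2 σ ↔ a₂ ∈ Z₂.D2 (restrL σ) ∨ a₃ ∈ Z₃.D2 (restrR σ) :=
  inl_a_mem_reach_markSet_iff Z₂ a₂ Z₃ a₃ σ false Z₂.at₂ Z₃.at₂ σ.2.2 false

/-- A `Z₂`-vertex is deleted iff it is deleted in `Z₂`, or the anchor is deleted and it lies in the anchor's blue
component of `Z₂`. -/
theorem inl_mem_D_iff (x : V₂) :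
    Sum.inl x ∈ (glue Z₂ a₂ Z₃ a₃).D σ ↔
      x ∈ Z₂.D (restrL σ) ∨ (Sum.inl a₂ ∈ (glue Z₂ a₂ Z₃ a₃).D σ ∧ x ∈ Z₂.P {a₂} (restrL σ)) := by
  rw [inl_a_mem_D_iff]
  have h := inl_mem_reach_iff Z₂ a₂ Z₃ a₃ false σ
    (markSet (Sum.elim (fun t => Sum.inl (Z₂.at₁ t)) (fun t => red a₂ a₃ (Z₃.at₁ t))) σ.2.1 false)
    (stray_not_mem_markSet_glue a₂ a₃ Z₂.at₁ Z₃.at₁ σ.2.1 false) x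
  rw [junction_markSet_iff] at h
  have e1 : leftSet (markSet (Sum.elim (fun t => Sum.inl (Z₂.at₁ t)) (fun t => red a₂ a₃ (Z₃.at₁ t))) σ.2.1 false)
      = {x | x ∈ Z₂.Bl (restrL σ) ∨ (x = a₂ ∧ a₃ ∈ Z₃.Bl (restrR σ))} := by
    ext x
    exact inl_mem_markSet_glue a₂ a₃ Z₂.at₁ Z₃.at₁ σ.2.1 false x
  rw [e1, mem_reach_union_condSingleton] at h
  refine h.trans ?_
  constructor
  · rintro ((h | ⟨h, hx⟩) | ⟨hj, hx⟩)
    · exact Or.inl h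
    · exact Or.inr ⟨Or.inr (mem_reach_of_mem h), hx⟩
    · exact Or.inr ⟨hj, hx⟩
  · rintro (h | ⟨hj, hx⟩)
    · exact Or.inl (Or.inl h)
    · exact Or.inr ⟨hj, hx⟩

/-- A `Z₃`-vertex is deleted iff it is not the stray vertex and is deleted in `Z₃`, or the anchor is deleted and it
lies in the anchor's blue component of `Z₃`. -/
theorem inr_mem_D_iff (y : V₃) :
    Sum.inr y ∈ (glue Z₂ a₂ Z₃ a₃).D σ ↔
      y ≠ a₃ ∧ (y ∈ Z₃.D (restrR σ) ∨ (Sum.inl a₂ ∈ (glue Z₂ a₂ Z₃ a₃).D σ ∧ y ∈ Z₃.P {a₃} (restrR σ))) := by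
  rw [inl_a_mem_D_iff]
  have h := inr_mem_reach_iff Z₂ a₂ Z₃ a₃ false σ
    (markSet (Sum.elim (fun t => Sum.inl (Z₂.at₁ t)) (fun t => red a₂ a₃ (Z₃.at₁ t))) σ.2.1 false)
    (stray_not_mem_markSet_glue a₂ a₃ Z₂.at₁ Z₃.at₁ σ.2.1 false) y
  rw [junction_markSet_iff] at h
  have e2 : rightSet (markSet (Sum.elim (fun t => Sum.inl (Z₂.at₁ t)) (fun t => red a₂ a₃ (Z₃.at₁ t))) σ.2.1 false)
      = {y | y ≠ a₃ ∧ y ∈ Z₃.Bl (restrR σ)} := by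
    ext y
    exact inr_mem_markSet_glue a₂ a₃ Z₂.at₁ Z₃.at₁ σ.2.1 false y
  rw [e2] at h
  refine h.trans (and_congr Iff.rfl ?_)
  have hD := mem_reach_iff_avoid (cAdj Z₃ false (restrR σ).1) (Z₃.Bl (restrR σ)) a₃ y
  constructor
  · rintro (h | ⟨hj, hy⟩)
    · exact Or.inl (hD.2 (Or.inl h))
    · exact Or.inr ⟨hj, hy⟩
  · rintro (h | ⟨hj, hy⟩)
    · rcases hD.1 h with h' | ⟨ha, hy⟩
      · exact Or.inl h'
      · exact Or.inr ⟨Or.inr ha, hy⟩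
    · exact Or.inr ⟨hj, hy⟩

end AnchorGlue

end ZoneZ

end PercRepro
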